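import Summits.Ventures.YMGap.Thresholds.SharpClusteringPoissonA
import Summits.Ventures.YMGap.Thresholds.LatticeBakryEmeryPoincare
import HarnessLib

/-!
# Venture YMGap — static exponential clustering, Part II-d:
# a functional `z ∈ H¹` orthogonal to `J(A𝒫)` is a multiple of the ground state

HONEST FRAMING: venture file (cell `pub-ymgap`, track (a), seat lit-1). Functional-analytic
plumbing for the static (semigroup-free) proof of Shen–Zhu–Zhu's mass-gap step
(`shenZhuZhu_massGap_transfer`); no physics and no number in this file.

Content. Let `S ∈ 𝒫_d`, `A = Δ - W` (`W = ¼Γ(S,S) + ½ΔS`, `schOp`) and let `z = (ψ, ζ) ∈ H¹` be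
orthogonal in `𝓗` to `J(Aq)` for every polynomial `q`. With `p_n ∈ 𝒫_n` representing `P_nψ`
(`exists_rep`) and `θ_n = (1-Δ)p_n`:
* `⟪θ_n, r⟫ = ⟪ψ, (1-Δ)r⟫` for `r ∈ 𝒫_m`, `m ≤ n` (`inner_theta_rep`), because `1-Δ` is symmetric
  and preserves `𝒫_m`; hence the martingale property `P_m θ_n = θ_m` (`starProjection_theta`);
* `‖θ_n‖ ≤ ‖ψ‖ + √C` by the `H²` bound of Part II-c (`norm_theta_le`, `energy_bound`);
* a bounded martingale of projections converges (`exists_tendsto_of_martingale`), so `θ_n → θ`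
  in `L²`; `θ ⊥ (Δ - W)𝒫`, and by the venture's ground-state theorem
  (`LatticeBakryEmery.ae_eq_groundState_of_orthogonal`, seat p2) `θ = m e^{S/2}` a.e.;
* consequently `⟪J s, z⟫ = ∫ (1-Δ)s · ψ = lim ∫ s θ_n = m ∫ s e^{S/2}` for every smooth `s`
  (`inner_sobJ_eq_groundState`): **on smooth functions, `z` is a multiple of the ground state**.
Part II-e turns this into the `H¹`-density of `J(A𝒫)` in `J{h smooth : ∫ h e^{S/2} = 0}`.

## References

* B. Helffer, J. Funct. Anal. 155 (1998) 571–586 (Witten Laplacian and correlation decay).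
* Venture files `LatticeBakryEmery{L2,Projection,GroundState,Poincare}.lean` (seat p2),
  `SharpClustering{Sobolev,WeakGrad,PoissonA}.lean` (this seat).
-/

noncomputable section

open scoped Matrix ComplexConjugate BigOperators Matrix.Norms.Frobenius ContDiff Topology InnerProductSpace
open Matrix Complex Finset MeasureTheory Filter
open Literature.MathematicalPhysics.QuantumFieldTheory

namespace Summit.Ventures.YMGap

namespace SharpClustering

open LatticeBakryEmery

universe u

variable {ι : Type u} [Fintype ι] [DecidableEq ι] {N : ℕ}

/-! ### Polynomial representatives of the projections `P_n ψ` -/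

omit [DecidableEq ι] in
/-- A polynomial representative of `P_n ψ`. -/
theorem exists_rep (ψ : Lp ℝ 2 (haarPi ι N)) (n : ℕ) :
    ∃ p : Cfg ι N → ℝ, ∃ hp : p ∈ polySpace ι N n,
      sL2 p (contDiff_of_mem_polySpace hp) = (VPoly ι N n).starProjection ψ := by
  have hmem : (VPoly ι N n).starProjection ψ ∈ VPoly ι N n := by
    simp only [Submodule.starProjection_apply]
    exact Submodule.coe_mem _
  obtain ⟨q, hq⟩ := LinearMap.mem_range.1 hmem
  exact ⟨q.1, q.2, hq⟩

/-! ### The sequence `θ_n = (1-Δ)p_n` -/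

/-- Inner products of `θ_n = (1-Δ)p_n` against `𝒫_m`, `m ≤ n`, do not depend on `n`:
`⟪θ_n, r⟫ = ⟪ψ, (1-Δ)r⟫`. -/
theorem inner_theta_rep (hN : N ≠ 0) {ψ : Lp ℝ 2 (haarPi ι N)} {n : ℕ} {p : Cfg ι N → ℝ}
    (hp : p ∈ polySpace ι N n)
    (hrep : sL2 p (contDiff_of_mem_polySpace hp) = (VPoly ι N n).starProjection ψ)
    {m : ℕ} (hmn : m ≤ n) {r : Cfg ι N → ℝ} (hr : r ∈ polySpace ι N m) :
    ⟪sL2 (oneSubLap p) (contDiff_oneSubLap (contDiff_of_mem_polySpace hp)),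
        sL2 r (contDiff_of_mem_polySpace hr)⟫_ℝ =
      ⟪ψ, sL2 (oneSubLap r) (contDiff_oneSubLap (contDiff_of_mem_polySpace hr))⟫_ℝ := by
  have hr' : oneSubLap r ∈ polySpace ι N n := polySpace_mono hmn (oneSubLap_mem_polySpace hr)
  rw [inner_sL2_sL2, integral_oneSubLap_mul_comm hN (contDiff_of_mem_polySpace hp)
    (contDiff_of_mem_polySpace hr), ← inner_eq_integral_rep hp hrep hr']

/-- The martingale property: `P_m θ_n = θ_m` for `m ≤ n`. -/
theorem starProjection_theta (hN : N ≠ 0) {ψ : Lp ℝ 2 (haarPi ι N)} {m n : ℕ} (hmn : m ≤ n)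
    {p : Cfg ι N → ℝ} (hp : p ∈ polySpace ι N n)
    (hrep : sL2 p (contDiff_of_mem_polySpace hp) = (VPoly ι N n).starProjection ψ)
    {p' : Cfg ι N → ℝ} (hp' : p' ∈ polySpace ι N m)
    (hrep' : sL2 p' (contDiff_of_mem_polySpace hp') = (VPoly ι N m).starProjection ψ) :
    (VPoly ι N m).starProjection (sL2 (oneSubLap p) (contDiff_oneSubLap (contDiff_of_mem_polySpace hp))) =
      sL2 (oneSubLap p') (contDiff_oneSubLap (contDiff_of_mem_polySpace hp')) := by
  refine Submodule.eq_starProjection_of_mem_of_inner_eq_zero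
    ⟨⟨oneSubLap p', oneSubLap_mem_polySpace hp'⟩, rfl⟩ fun w hw => ?_
  obtain ⟨q, rfl⟩ := LinearMap.mem_range.1 hw
  have e : TPoly m q = sL2 q.1 (contDiff_of_mem_polySpace q.2) := rfl
  rw [e, inner_sub_left, inner_theta_rep hN hp hrep hmn q.2, inner_theta_rep hN hp' hrep' le_rfl q.2,
    sub_self]

/-- Norm bound: `‖θ_n‖ ≤ ‖ψ‖ + √D` whenever `∫ (Δp_n)² ≤ D`. -/
theorem norm_theta_le {ψ : Lp ℝ 2 (haarPi ι N)} {n : ℕ} {p : Cfg ι N → ℝ} (hp : p ∈ polySpace ι N n)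
    (hrep : sL2 p (contDiff_of_mem_polySpace hp) = (VPoly ι N n).starProjection ψ) {D : ℝ}
    (hD : ∫ g : PSU ι N, Lap p (emb g) ^ 2 ∂(haarPi ι N) ≤ D) :
    ‖sL2 (oneSubLap p) (contDiff_oneSubLap (contDiff_of_mem_polySpace hp))‖ ≤ ‖ψ‖ + Real.sqrt D := by
  have hpc : ContDiff ℝ ∞ p := contDiff_of_mem_polySpace hp
  have e : sL2 (oneSubLap p) (contDiff_oneSubLap hpc) = sL2 p hpc - sL2 (Lap p) (contDiff_Lap hpc) := by
    rw [← sL2_sub]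
    exact sL2_congr _ _ rfl
  rw [e]
  refine (norm_sub_le _ _).trans (add_le_add ?_ ?_)
  · rw [hrep]
    exact Submodule.norm_starProjection_apply_le _ _
  · rw [← Real.sqrt_sq (norm_nonneg _), norm_sL2_sq]
    exact Real.sqrt_le_sqrt hD

/-! ### Convergence of a bounded martingale of projections -/

omit [DecidableEq ι] in
/-- A sequence `θ_n ∈ V_n` with `P_m θ_n = θ_m` (`m ≤ n`) and bounded norms converges in `L²`:
`‖θ_n‖²` is monotone and bounded, and `‖θ_n - θ_m‖² = ‖θ_n‖² - ‖θ_m‖²`. -/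
theorem exists_tendsto_of_martingale {θ : ℕ → Lp ℝ 2 (haarPi ι N)} (hmem : ∀ n, θ n ∈ VPoly ι N n)
    (hmart : ∀ m n, m ≤ n → (VPoly ι N m).starProjection (θ n) = θ m) {B : ℝ} (hB : ∀ n, ‖θ n‖ ≤ B) :
    ∃ θ' : Lp ℝ 2 (haarPi ι N), Tendsto θ atTop (𝓝 θ') := by
  -- Pythagoras
  have hpy : ∀ m n, m ≤ n → ‖θ n‖ ^ 2 = ‖θ m‖ ^ 2 + ‖θ n - θ m‖ ^ 2 := by
    intro m n hmn
    have horth : ⟪θ m, θ n - θ m⟫_ℝ = 0 := by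
      rw [real_inner_comm]
      have h := Submodule.starProjection_inner_eq_zero (K := VPoly ι N m) (θ n) (θ m) (hmem m)
      rwa [hmart m n hmn] at h
    have h1 := norm_add_sq_real (θ m) (θ n - θ m)
    rw [add_sub_cancel, horth] at h1
    linarith
  have hmono : Monotone fun n => ‖θ n‖ ^ 2 := by
    refine monotone_nat_of_le_succ fun n => ?_
    have := hpy n (n + 1) (Nat.le_succ n)
    nlinarith [sq_nonneg ‖θ (n + 1) - θ n‖]
  have hbdd : BddAbove (Set.range fun n => ‖θ n‖ ^ 2) := by
    refine ⟨B ^ 2, ?_⟩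
    rintro _ ⟨n, rfl⟩
    exact pow_le_pow_left₀ (norm_nonneg _) (hB n) 2
  have hconv : Tendsto (fun n => ‖θ n‖ ^ 2) atTop (𝓝 (⨆ n, ‖θ n‖ ^ 2)) := tendsto_atTop_ciSup hmono hbdd
  have hC : CauchySeq θ := by
    refine Metric.cauchySeq_iff'.2 fun ε hε => ?_
    obtain ⟨M, hM⟩ := Metric.tendsto_atTop.1 hconv (ε ^ 2 / 2) (by positivity)
    refine ⟨M, fun n hn => ?_⟩
    have h1 := abs_lt.1 (by simpa [Real.dist_eq] using hM n hn)
    have h2 := abs_lt.1 (by simpa [Real.dist_eq] using hM M le_rfl)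
    have e1 := hpy M n hn
    have h3 : ‖θ n - θ M‖ ^ 2 < ε ^ 2 := by linarith [h1.1, h1.2, h2.1, h2.2]
    have h4 : ‖θ n - θ M‖ < ε := lt_of_pow_lt_pow_left₀ 2 hε.le h3
    rwa [dist_eq_norm]
  exact cauchySeq_tendsto_of_complete hC

/-! ### The main theorem -/

/-- **Main theorem of Part II-d.** If `z = (ψ, ζ) ∈ H¹` is orthogonal to `J(Aq)` for every
polynomial `q` (`A = Δ - W`), then on smooth functions `z` is a multiple of the ground state:
`⟪J s, z⟫ = m ∫ s e^{S/2} dσ^{⊗E}` for one `m ∈ ℝ` and every smooth `s`. -/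
theorem inner_sobJ_eq_groundState (hN : N ≠ 0) {dS : ℕ} {S : Cfg ι N → ℝ} (hSp : S ∈ polySpace ι N dS)
    {z : HSp ι N} (hz : z ∈ HOne ι N)
    (horth : ∀ (m : ℕ) (q : Cfg ι N → ℝ) (hq : q ∈ polySpace ι N m),
      ⟪sobJ (schOp S q) (contDiff_schOp (contDiff_of_mem_polySpace hSp) (contDiff_of_mem_polySpace hq)), z⟫_ℝ = 0) :
    ∃ m : ℝ, ∀ (s : Cfg ι N → ℝ) (hs : ContDiff ℝ ∞ s),
      ⟪sobJ s hs, z⟫_ℝ = m * ∫ g : PSU ι N, s (emb g) * Real.exp (S (emb g) / 2) ∂(haarPi ι N) := by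
  have hS : ContDiff ℝ ∞ S := contDiff_of_mem_polySpace hSp
  -- representatives `p n` of `P_n ψ` and the sequence `θ n = (1-Δ)(p n)`
  have hex := fun n => exists_rep (ι := ι) z.fst n
  choose p hp hrep using hex
  have hpc : ∀ n, ContDiff ℝ ∞ (p n) := fun n => contDiff_of_mem_polySpace (hp n)
  obtain ⟨θ, hθ⟩ : ∃ θ : ℕ → Lp ℝ 2 (haarPi ι N),
      ∀ n, θ n = sL2 (oneSubLap (p n)) (contDiff_oneSubLap (contDiff_of_mem_polySpace (hp n))) :=
    ⟨_, fun n => rfl⟩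
  obtain ⟨C, -, hC⟩ := energy_bound hN hSp hz horth
  have hθmem : ∀ n, θ n ∈ VPoly ι N n := fun n => by
    rw [hθ n]; exact ⟨⟨oneSubLap (p n), oneSubLap_mem_polySpace (hp n)⟩, rfl⟩
  have hmart : ∀ m n, m ≤ n → (VPoly ι N m).starProjection (θ n) = θ m := fun m n hmn => by
    rw [hθ n, hθ m]; exact starProjection_theta hN hmn (hp n) (hrep n) (hp m) (hrep m)
  have hB : ∀ n, ‖θ n‖ ≤ ‖z.fst‖ + Real.sqrt C := fun n => by
    rw [hθ n]; exact norm_theta_le (hp n) (hrep n) (hC n (p n) (hp n) (hrep n)).2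
  obtain ⟨θ', hθ'⟩ := exists_tendsto_of_martingale hθmem hmart hB
  -- `θ' ⊥ (Δ - W)𝒫`
  have hθ'orth : ∀ k, ∀ q ∈ polySpace ι N k,
      ∫ g : PSU ι N, θ' g * (Lap q (emb g) - schW S (emb g) * q (emb g)) ∂(haarPi ι N) = 0 := by
    intro k q hq
    have hqm : schOp S q ∈ polySpace ι N (k + (dS + dS)) := schOp_mem_polySpace hSp hq
    have hqc : ContDiff ℝ ∞ (schOp S q) := contDiff_of_mem_polySpace hqm
    have e1 : ∫ g : PSU ι N, θ' g * (Lap q (emb g) - schW S (emb g) * q (emb g)) ∂(haarPi ι N) =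
        ⟪sL2 (schOp S q) hqc, θ'⟫_ℝ := by
      rw [inner_sL2_left]
      exact integral_congr_ae (ae_of_all _ fun g => by simp only [schOp]; ring)
    rw [e1]
    have ht : Tendsto (fun n => ⟪sL2 (schOp S q) hqc, θ n⟫_ℝ) atTop (𝓝 ⟪sL2 (schOp S q) hqc, θ'⟫_ℝ) :=
      tendsto_const_nhds.inner hθ'
    have hev : ∀ n, k + (dS + dS) ≤ n → ⟪sL2 (schOp S q) hqc, θ n⟫_ℝ = 0 := by
      intro n hn
      rw [real_inner_comm, hθ n, inner_theta_rep hN (hp n) (hrep n) hn hqm, real_inner_comm, inner_sL2_left,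
        ← inner_sobJ_eq_integral_oneSubLap hN hz hqc]
      exact horth k q hq
    have hlim : Tendsto (fun n => ⟪sL2 (schOp S q) hqc, θ n⟫_ℝ) atTop (𝓝 0) :=
      tendsto_const_nhds.congr' (eventually_atTop.2 ⟨k + (dS + dS), fun n hn => (hev n hn).symm⟩)
    exact tendsto_nhds_unique ht hlim
  -- the ground state
  obtain ⟨m, hm⟩ := ae_eq_groundState_of_orthogonal hN hSp θ' hθ'orth
  refine ⟨m, fun s hs => ?_⟩
  have hsc1 : ContDiff ℝ ∞ (oneSubLap s) := contDiff_oneSubLap hs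
  have e1 : ⟪sobJ s hs, z⟫_ℝ = ⟪sL2 (oneSubLap s) hsc1, z.fst⟫_ℝ := by
    rw [inner_sobJ_eq_integral_oneSubLap hN hz hs, inner_sL2_left]
  have hP : Tendsto (fun n => sL2 (p n) (hpc n)) atTop (𝓝 z.fst) := by
    have := Submodule.starProjection_tendsto_self (VPoly ι N) monotone_VPoly z.fst top_le_closure_iSup_VPoly
    exact this.congr fun n => (hrep n).symm
  have e2 : ∀ n, ⟪sL2 (oneSubLap s) hsc1, sL2 (p n) (hpc n)⟫_ℝ = ⟪sL2 s hs, θ n⟫_ℝ := by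
    intro n
    rw [hθ n, inner_sL2_sL2, inner_sL2_sL2, integral_oneSubLap_mul_comm hN hs (hpc n)]
  have t1 : Tendsto (fun n => ⟪sL2 s hs, θ n⟫_ℝ) atTop (𝓝 ⟪sL2 (oneSubLap s) hsc1, z.fst⟫_ℝ) :=
    (tendsto_const_nhds.inner hP).congr e2
  have t2 : Tendsto (fun n => ⟪sL2 s hs, θ n⟫_ℝ) atTop (𝓝 ⟪sL2 s hs, θ'⟫_ℝ) := tendsto_const_nhds.inner hθ'
  rw [e1, tendsto_nhds_unique t1 t2, inner_sL2_left, ← integral_const_mul]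
  refine integral_congr_ae ?_
  filter_upwards [hm] with g hg
  rw [hg]
  ring

end SharpClustering

end Summit.Ventures.YMGap
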